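import Summits.KontsevichZagierPeriods.KontsevichZagierPeriods.Theorems.HurwitzMicroSectorsNormalFormPrincipleDilogExistsBoxAtoms
import Literature.NumberTheory.Transcendental.KZProductIdeal
import Literature.NumberTheory.Transcendental.KZDominatedFamilyRelations
import Literature.Analysis.SpecialFunctions.SelbergLimit

/-!
# `NormalFormPrinciple` (stmt-KontsevichZagierPeriods-3869), line `SketchIdeator1` —
# leaf `stub_boxRigidity`, dilogarithm layer: the square kit of Landen's identity

Pure proof file (stub `square_kit` of the layer `Dilog`, lead seat c9; `--supports` the crux).
In Landen's functional equation the term `−log²(1 − z)` is carried by the SQUARE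
`R(z) = [(0,z)², 1/((1 − t₀)(1 − t₁))]`, which is reached

1. from the TRIANGLE `Q(z) = [{0 < t₁ < t₀ < z}, 1/((1 − t₀)(1 − t₁))]` by symmetrisation:
   `2[Q] − [R] ∈ KZ.relations`. Moves: the coordinate swap `t₀ ↔ t₁` is a change of variables
   (`KZ.of_sub_of_reindex_mem_relations`, rule 2) carrying `Q` onto the mirror triangle `Qˢ` with
   the same (symmetric) integrand; the square minus the two open triangles is the diagonal
   `{t₀ = t₁}`, a Lebesgue-null proper linear subspace (`Selberg.volume_setOf_apply_eq`), so
   `[R] ≡ [R|_{Q ∪ Qˢ}]`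
   (`KZ.IntegralRep.of_sub_of_restrict_mem_relations`, rule 1); and
   `[R|_{Q ∪ Qˢ}] − [Q] − [Qˢ]` is a raw domain-additivity move (rule 1).
2. from the log-product BOX `P(a − 1, a − 1) = [(0,1)², 1/(((a − 1) + x₀)((a − 1) + x₁))]`
   (`a > 1` real algebraic, `az = 1`) by ONE affine change of variables (rule 2)
   `x ↦ (z − z x₀, z − z x₁)` of the open unit box onto `(0,z)²`, Jacobian `z²`, with the
   pull-back identity `z²/((1 − z + z x₀)(1 − z + z x₁)) = 1/(((a − 1) + x₀)((a − 1) + x₁))`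
   (as `1 − z + z xᵢ = z((a − 1) + xᵢ)` when `az = 1`): `[P] − [R] ∈ KZ.changeOfVariablesRel`.

References: M. Kontsevich, D. Zagier, *Periods* (2001), §1.1–1.2 (rules (1), (2)).
No definitions are introduced.
-/

noncomputable section

open MeasureTheory Set
open Literature.NumberTheory.Transcendental Literature.NumberTheory.Transcendental.KZ
open Literature.ModelTheory.ExponentialFields (IsSemialgebraic)

namespace Summit.KontsevichZagierPeriods.HurwitzMicroSectors.NormalFormPrinciple.PiBox.Dilog

/-! ## Part (1): symmetrisation of the triangle `{0 < t₁ < t₀ < z}` -/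

/-- **The mirror triangle.** Reading the triangle `Q = [{0 < t₁ < t₀ < z}, 1/((1 − t₀)(1 − t₁))]`
through the coordinate swap `t₀ ↔ t₁` gives a representation `Qˢ` with domain `{0 < t₀ < t₁ < z}`
and the same (symmetric) integrand on it, and `[Q] − [Qˢ]` is a change-of-variables relation
(`KZ.of_sub_of_reindex_mem_relations`). [cite: KontsevichZagier2001, §1.2 rule (2)] -/
theorem sqk_exists_mirror {z : ℝ} (Q : IntegralRep 2)
    (hQd : Q.domain = {t | 0 < t 1 ∧ t 1 < t 0 ∧ t 0 < z})
    (hQi : EqOn Q.integrand (fun t => 1 / ((1 - t 0) * (1 - t 1))) Q.domain) :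
    ∃ Qs : IntegralRep 2, Qs.domain = {t | 0 < t 0 ∧ t 0 < t 1 ∧ t 1 < z} ∧
      EqOn Qs.integrand (fun t => 1 / ((1 - t 0) * (1 - t 1))) Qs.domain ∧
      of Q - of Qs ∈ relations := by
  refine ⟨Q.reindex (Equiv.swap (0 : Fin 2) 1), ?_, ?_,
    of_sub_of_reindex_mem_relations Q (Equiv.swap (0 : Fin 2) 1)⟩
  · ext w
    simp only [IntegralRep.reindex_domain, hQd, mem_setOf_eq, Equiv.swap_apply_left,
      Equiv.swap_apply_right]
  · intro w hw
    have hw' : (fun i => w (Equiv.swap (0 : Fin 2) 1 i)) ∈ Q.domain := hw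
    rw [IntegralRep.reindex_integrand]
    show Q.integrand (fun i => w (Equiv.swap (0 : Fin 2) 1 i)) = _
    rw [hQi hw']
    simp only [Equiv.swap_apply_left, Equiv.swap_apply_right]
    ring

/-- **Symmetrisation of the triangle (rules 1, 2).** For the triangle
`Q = [{0 < t₁ < t₀ < z}, 1/((1 − t₀)(1 − t₁))]` and the square `R = [(0,z)², 1/((1 − t₀)(1 − t₁))]`,
`2[Q] − [R] ∈ KZ.relations`: the square is the union of `Q`, its mirror `Qˢ` (swap of coordinates,
rule 2) and the null diagonal `{t₀ = t₁}` (rule 1). [cite: KontsevichZagier2001, §1.2 rules (1), (2)] -/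
theorem sqk_two_smul_triangle_sub_square {z : ℝ} (Q R : IntegralRep 2)
    (hQd : Q.domain = {t | 0 < t 1 ∧ t 1 < t 0 ∧ t 0 < z})
    (hQi : EqOn Q.integrand (fun t => 1 / ((1 - t 0) * (1 - t 1))) Q.domain)
    (hRd : R.domain = {t | 0 < t 0 ∧ t 0 < z ∧ 0 < t 1 ∧ t 1 < z})
    (hRi : EqOn R.integrand (fun t => 1 / ((1 - t 0) * (1 - t 1))) R.domain) :
    2 • of Q - of R ∈ relations := by
  -- (rule 2) the mirror triangle `Qs`
  obtain ⟨Qs, hQsd, hQsi, e2⟩ := sqk_exists_mirror Q hQd hQi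
  -- (rule 1) the square minus the two triangles is the null diagonal
  have hE : IsSemialgebraic ℚ (Q.domain ∪ Qs.domain) :=
    Q.isSemialgebraic_domain.union Qs.isSemialgebraic_domain
  have hER : Q.domain ∪ Qs.domain ⊆ R.domain := by
    rintro t (ht | ht)
    · rw [hQd] at ht
      rw [hRd]
      exact ⟨ht.1.trans ht.2.1, ht.2.2, ht.1, ht.2.1.trans ht.2.2⟩
    · rw [hQsd] at ht
      rw [hRd]
      exact ⟨ht.1, ht.2.1.trans ht.2.2, ht.1.trans ht.2.1, ht.2.2⟩
  have hvol : volume (R.domain \ (Q.domain ∪ Qs.domain)) = 0 := by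
    -- the diagonal `{t₀ = t₁}` is null (`Selberg.volume_setOf_apply_eq`, a proper linear subspace)
    refine measure_mono_null (fun t ht => ?_)
      (Literature.Analysis.SpecialFunctions.Selberg.volume_setOf_apply_eq
        (n := 2) (p := 0) (q := 1) (by decide))
    rw [hRd, hQd, hQsd] at ht
    obtain ⟨⟨h0, h0z, h1, h1z⟩, hnot⟩ := ht
    by_contra hne
    rcases lt_or_gt_of_ne hne with hlt | hlt
    · exact hnot (Or.inr ⟨h0, hlt, h1z⟩)
    · exact hnot (Or.inl ⟨h1, hlt, h0z⟩)
  have e0 : of R - of (R.restrict (Q.domain ∪ Qs.domain) hE hER) ∈ relations :=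
    R.of_sub_of_restrict_mem_relations hE hER hvol
  -- (rule 1) domain additivity: the two open triangles are disjoint
  have e1 : of (R.restrict (Q.domain ∪ Qs.domain) hE hER) - of Q - of Qs ∈ relations := by
    refine domainAddRel_subset_relations
      ⟨2, R.restrict (Q.domain ∪ Qs.domain) hE hER, Q, Qs, rfl, ?_, ?_, ?_, rfl⟩
    · have h : Q.domain ∩ Qs.domain = ∅ := by
        rw [hQd, hQsd]
        ext t
        simp only [mem_inter_iff, mem_setOf_eq, mem_empty_iff_false, iff_false]
        rintro ⟨⟨_, h₁, _⟩, ⟨_, h₂, _⟩⟩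
        exact lt_asymm h₁ h₂
      rw [h, measure_empty]
    · intro t ht
      show R.integrand t = Q.integrand t
      rw [hRi (hER (Or.inl ht)), hQi ht]
    · intro w hw
      show R.integrand w = Qs.integrand w
      rw [hRi (hER (Or.inr hw)), hQsi hw]
  -- bookkeeping
  have e : 2 • of Q - of R = (of Q - of Qs) -
      (of (R.restrict (Q.domain ∪ Qs.domain) hE hER) - of Q - of Qs) -
      (of R - of (R.restrict (Q.domain ∪ Qs.domain) hE hER)) := by
    abel
  rw [e]
  exact relations.sub_mem (relations.sub_mem e2 e1) e0

/-! ## Part (2): the affine chart `x ↦ (z − z x₀, z − z x₁)` of the box onto `(0,z)²` -/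

/-- **The pull-back identity** of the affine chart (Jacobian `z²` included): if `az = 1` and
`z ≠ 0` then `1/(((a − 1) + u)((a − 1) + v)) = 1/((1 − (z − zu))(1 − (z − zv))) · z²`, since
`1 − z + zu = z((a − 1) + u)`. [folklore] -/
theorem sqk_affine_pullback {a z : ℝ} (haz : a * z = 1) (hz : z ≠ 0) (u v : ℝ) :
    1 / ((a - 1 + u) * (a - 1 + v)) = 1 / ((1 - (z - z * u)) * (1 - (z - z * v))) * z ^ 2 := by
  have e0 : 1 - (z - z * u) = z * (a - 1 + u) := by linear_combination (-1 : ℝ) * haz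
  have e1 : 1 - (z - z * v) = z * (a - 1 + v) := by linear_combination (-1 : ℝ) * haz
  rw [e0, e1, show z * (a - 1 + u) * (z * (a - 1 + v)) = z ^ 2 * ((a - 1 + u) * (a - 1 + v)) by ring,
    div_mul_eq_mul_div, one_mul, div_mul_cancel_left₀ (pow_ne_zero 2 hz), one_div]

/-- **The affine chart `Φ(x) = (z − z x₀, z − z x₁)`** of the open unit box onto the open square
`(0,z)²` (`z > 0` real algebraic): a `ℚ`-semialgebraic map (its coefficients are real algebraic),
differentiable with constant derivative `diag(−z, −z)` of determinant `z²`, injective, and ONTO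
`(0,z)²` (inverse `xᵢ = 1 − tᵢ/z`). [folklore] -/
theorem sqk_exists_affineChart {z : ℝ} (hz : IsAlgebraic ℚ z) (hz0 : 0 < z) :
    ∃ (Φ : (Fin 2 → ℝ) → (Fin 2 → ℝ)) (Φ' : (Fin 2 → ℝ) → (Fin 2 → ℝ) →L[ℝ] (Fin 2 → ℝ)),
      (∀ x, Φ x 0 = z - z * x 0) ∧ (∀ x, Φ x 1 = z - z * x 1) ∧
      IsSemialgebraicMapOn ℚ {x : Fin 2 → ℝ | ∀ i, x i ∈ Set.Ioo (0:ℝ) 1} Φ ∧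
      (∀ x, HasFDerivAt Φ (Φ' x) x) ∧
      Set.InjOn Φ {x : Fin 2 → ℝ | ∀ i, x i ∈ Set.Ioo (0:ℝ) 1} ∧
      Φ '' {x : Fin 2 → ℝ | ∀ i, x i ∈ Set.Ioo (0:ℝ) 1} =
        {t : Fin 2 → ℝ | 0 < t 0 ∧ t 0 < z ∧ 0 < t 1 ∧ t 1 < z} ∧
      (∀ x, (Φ' x).det = z ^ 2) := by
  set Φ : (Fin 2 → ℝ) → (Fin 2 → ℝ) := fun x => ![z - z * x 0, z - z * x 1] with hΦ
  set L : (Fin 2 → ℝ) →L[ℝ] (Fin 2 → ℝ) :=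
    LinearMap.toContinuousLinearMap (Matrix.toLin' !![-z, 0; 0, -z]) with hL
  have hΦ0 : ∀ x, Φ x 0 = z - z * x 0 := fun x => rfl
  have hΦ1 : ∀ x, Φ x 1 = z - z * x 1 := fun x => rfl
  have hL0 : ∀ v : Fin 2 → ℝ, L v 0 = -(z * v 0) := by
    intro v
    change Matrix.toLin' !![-z, 0; 0, -z] v 0 = _
    rw [Matrix.toLin'_apply]
    simp [Matrix.mulVec, dotProduct, Fin.sum_univ_two]
  have hL1 : ∀ v : Fin 2 → ℝ, L v 1 = -(z * v 1) := by
    intro v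
    change Matrix.toLin' !![-z, 0; 0, -z] v 1 = _
    rw [Matrix.toLin'_apply]
    simp [Matrix.mulVec, dotProduct, Fin.sum_univ_two]
  have hdet : L.det = z ^ 2 := by
    change LinearMap.det (Matrix.toLin' !![-z, 0; 0, -z]) = _
    rw [LinearMap.det_toLin', Matrix.det_fin_two_of]
    ring
  have hderiv : ∀ x, HasFDerivAt Φ L x := by
    intro x
    have h0 : HasFDerivAt (fun y : Fin 2 → ℝ => y 0)
        (ContinuousLinearMap.proj (R := ℝ) (φ := fun _ : Fin 2 => ℝ) 0) x := hasFDerivAt_apply 0 x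
    have h1 : HasFDerivAt (fun y : Fin 2 → ℝ => y 1)
        (ContinuousLinearMap.proj (R := ℝ) (φ := fun _ : Fin 2 => ℝ) 1) x := hasFDerivAt_apply 1 x
    rw [hasFDerivAt_pi']
    refine Fin.forall_fin_two.mpr ⟨?_, ?_⟩
    · have hf : (fun y : Fin 2 → ℝ => Φ y 0) = fun y => z - z * y 0 := funext fun y => hΦ0 y
      rw [hf]
      refine ((hasFDerivAt_const z x).sub (h0.const_mul z)).congr_fderiv
        (ContinuousLinearMap.ext fun v => ?_)
      simp [hL0]
    · have hf : (fun y : Fin 2 → ℝ => Φ y 1) = fun y => z - z * y 1 := funext fun y => hΦ1 y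
      rw [hf]
      refine ((hasFDerivAt_const z x).sub (h1.const_mul z)).congr_fderiv
        (ContinuousLinearMap.ext fun v => ?_)
      simp [hL1]
  refine ⟨Φ, fun _ => L, hΦ0, hΦ1, ?_, hderiv, ?_, ?_, fun _ => hdet⟩
  · -- `ℚ`-semialgebraic: affine with real-algebraic coefficients
    have hB := isSemialgebraic_box 2
    refine IsSemialgebraicMapOn.of_forall hB (Fin.forall_fin_two.mpr ⟨?_, ?_⟩)
    · exact (IsSemialgebraicFunOn.sub_holds (isSemialgebraicFunOn_const_of_isAlgebraic hB hz)
        (IsSemialgebraicFunOn.mul_holds (isSemialgebraicFunOn_const_of_isAlgebraic hB hz)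
          (isSemialgebraicFunOn_apply hB 0))).congr fun _ _ => rfl
    · exact (IsSemialgebraicFunOn.sub_holds (isSemialgebraicFunOn_const_of_isAlgebraic hB hz)
        (IsSemialgebraicFunOn.mul_holds (isSemialgebraicFunOn_const_of_isAlgebraic hB hz)
          (isSemialgebraicFunOn_apply hB 1))).congr fun _ _ => rfl
  · -- injective (`z ≠ 0`)
    intro x _ y _ hxy
    have e0 : z - z * x 0 = z - z * y 0 := by rw [← hΦ0, ← hΦ0, hxy]
    have e1 : z - z * x 1 = z - z * y 1 := by rw [← hΦ1, ← hΦ1, hxy]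
    have h0 : x 0 = y 0 := mul_left_cancel₀ hz0.ne' (sub_right_injective e0)
    have h1 : x 1 = y 1 := mul_left_cancel₀ hz0.ne' (sub_right_injective e1)
    funext i
    fin_cases i
    · exact h0
    · exact h1
  · -- onto the open square `(0,z)²`
    ext t
    constructor
    · rintro ⟨x, hx, rfl⟩
      have h0 := hx 0
      have h1 := hx 1
      rw [mem_setOf_eq, hΦ0, hΦ1]
      refine ⟨?_, sub_lt_self z (mul_pos hz0 h0.1), ?_, sub_lt_self z (mul_pos hz0 h1.1)⟩
      · have e : z - z * x 0 = z * (1 - x 0) := by ring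
        rw [e]
        exact mul_pos hz0 (sub_pos.2 h0.2)
      · have e : z - z * x 1 = z * (1 - x 1) := by ring
        rw [e]
        exact mul_pos hz0 (sub_pos.2 h1.2)
    · rintro ⟨h0, h0z, h1, h1z⟩
      refine ⟨fun i => 1 - t i / z, Fin.forall_fin_two.mpr
        ⟨⟨sub_pos.2 ((div_lt_one hz0).2 h0z), sub_lt_self 1 (div_pos h0 hz0)⟩,
          ⟨sub_pos.2 ((div_lt_one hz0).2 h1z), sub_lt_self 1 (div_pos h1 hz0)⟩⟩, ?_⟩
      funext i
      fin_cases i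
      · change z - z * (1 - t 0 / z) = t 0
        rw [mul_sub, mul_one, mul_div_cancel₀ _ hz0.ne', sub_sub_cancel]
      · change z - z * (1 - t 1 / z) = t 1
        rw [mul_sub, mul_one, mul_div_cancel₀ _ hz0.ne', sub_sub_cancel]

/-- **The affine identification of the log-product box with the square (rule 2).** For real
algebraic `a > 1` with `az = 1`, the log-product box
`P = [(0,1)², 1/(((a − 1) + x₀)((a − 1) + x₁))]` and the square `R = [(0,z)², 1/((1 − t₀)(1 − t₁))]`
satisfy `[P] − [R] ∈ KZ.relations`: ONE change of variables `x ↦ (z − z x₀, z − z x₁)`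
(`sqk_exists_affineChart`) with the pull-back identity `sqk_affine_pullback`.
[cite: KontsevichZagier2001, §1.2 rule (2)] -/
theorem sqk_box_sub_square {a z : ℝ} (ha : IsAlgebraic ℚ a) (ha1 : 1 < a) (haz : a * z = 1)
    (R P : IntegralRep 2)
    (hRd : R.domain = {t | 0 < t 0 ∧ t 0 < z ∧ 0 < t 1 ∧ t 1 < z})
    (hRi : EqOn R.integrand (fun t => 1 / ((1 - t 0) * (1 - t 1))) R.domain)
    (hPd : P.domain = {x | ∀ i, x i ∈ Set.Ioo (0:ℝ) 1})
    (hPi : EqOn P.integrand (fun x => 1 / (((a - 1) + x 0) * ((a - 1) + x 1))) P.domain) :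
    of P - of R ∈ relations := by
  have ha0 : 0 < a := one_pos.trans ha1
  have hza : z = a⁻¹ := eq_inv_of_mul_eq_one_right haz
  have hz0 : 0 < z := by rw [hza]; exact inv_pos.2 ha0
  have hzalg : IsAlgebraic ℚ z := by rw [hza]; exact ha.inv
  obtain ⟨Φ, Φ', hΦ0, hΦ1, hsa, hderiv, hinj, himage, hdet⟩ := sqk_exists_affineChart hzalg hz0
  have himage' : R.domain = Φ '' P.domain := by rw [hPd, himage, hRd]
  have hsa' : IsSemialgebraicMapOn ℚ P.domain Φ := by rw [hPd]; exact hsa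
  have hinj' : InjOn Φ P.domain := by rw [hPd]; exact hinj
  refine changeOfVariablesRel_subset_relations
    ⟨2, P, R, Φ, Φ', hsa', fun x _ => (hderiv x).hasFDerivWithinAt, hinj', himage',
      fun x hx => ?_, rfl⟩
  -- the pull-back identity on the box, Jacobian `|det DΦ| = z²` included
  have hΦx : Φ x ∈ R.domain := himage' ▸ mem_image_of_mem _ hx
  rw [hPi hx, hRi hΦx, hdet x, abs_of_pos (pow_pos hz0 2)]
  show 1 / ((a - 1 + x 0) * (a - 1 + x 1)) = 1 / ((1 - Φ x 0) * (1 - Φ x 1)) * z ^ 2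
  rw [hΦ0, hΦ1]
  exact sqk_affine_pullback haz hz0.ne' (x 0) (x 1)

/-! ## The registered sub-goal -/

/-- **Stub `square_kit` (the square kit of Landen's identity; registered sub-goal of
stmt-KontsevichZagierPeriods-3869, line `SketchIdeator1`, layer `Dilog`).**
(1) Symmetrisation: for real algebraic `0 < z < 1`, the triangle
`Q = [{0 < t₁ < t₀ < z}, 1/((1 − t₀)(1 − t₁))]` and the square `R = [(0,z)², 1/((1 − t₀)(1 − t₁))]`
satisfy `2[Q] − [R] ∈ KZ.relations` (coordinate swap, rule 2; null diagonal and domain additivity,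
rule 1). (2) For real algebraic `a > 1` with `az = 1`, the log-product box
`P = [(0,1)², 1/(((a − 1) + x₀)((a − 1) + x₁))]` and the square `R` satisfy `[P] − [R] ∈ KZ.relations`
(one affine change of variables `x ↦ (z − z x₀, z − z x₁)`, rule 2).
[cite: KontsevichZagier2001, §1.2 rules (1), (2)] -/
theorem square_kit :
    (∀ (z : ℝ), IsAlgebraic ℚ z → 0 < z → z < 1 → ∀ (Q R : IntegralRep 2),
      Q.domain = {t | 0 < t 1 ∧ t 1 < t 0 ∧ t 0 < z} →
      EqOn Q.integrand (fun t => 1 / ((1 - t 0) * (1 - t 1))) Q.domain →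
      R.domain = {t | 0 < t 0 ∧ t 0 < z ∧ 0 < t 1 ∧ t 1 < z} →
      EqOn R.integrand (fun t => 1 / ((1 - t 0) * (1 - t 1))) R.domain →
      2 • of Q - of R ∈ relations) ∧
    (∀ (a z : ℝ), IsAlgebraic ℚ a → 1 < a → a * z = 1 → ∀ (R P : IntegralRep 2),
      R.domain = {t | 0 < t 0 ∧ t 0 < z ∧ 0 < t 1 ∧ t 1 < z} →
      EqOn R.integrand (fun t => 1 / ((1 - t 0) * (1 - t 1))) R.domain →
      P.domain = {x | ∀ i, x i ∈ Set.Ioo (0:ℝ) 1} →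
      EqOn P.integrand (fun x => 1 / (((a - 1) + x 0) * ((a - 1) + x 1))) P.domain →
      of P - of R ∈ relations) :=
  ⟨fun _ _ _ _ Q R hQd hQi hRd hRi => sqk_two_smul_triangle_sub_square Q R hQd hQi hRd hRi,
    fun _ _ ha ha1 haz R P hRd hRi hPd hPi => sqk_box_sub_square ha ha1 haz R P hRd hRi hPd hPi⟩

end Summit.KontsevichZagierPeriods.HurwitzMicroSectors.NormalFormPrinciple.PiBox.Dilog
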